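import Summits.QuantumFields.GaugeBoot.CubicTorusLinkRPAnyBeta
import HarnessLib

/-!
# The staggered central twist on Wilson loops: `⟨W̄(R×T)⟩_{-β} = (-1)^{RT} ⟨W̄(R×T)⟩_β` for `SU(2n)`
# on even tori (gauge-boot, L3 structural supplement, part 3b)

HONEST FRAMING (cell `pub-gaugeboot`, page 1 of every file): the venture produces certified bounds
on lattice expectations at stated coupling, gauge group, dimension and torus size; NOT a mass gap,
NOT a continuum limit, NOT a string tension; NOT Yang–Mills-summit-bearing (barriers
`FixedCouplingUltralocality`, `PerturbativeInvisibility`). This module bounds no expectation; no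
certificate of the cell sits at `β < 0`.

Parts 1–3 (`StaggeredCentralTwist`, `StaggeredParityTwist`, `CubicTorusLinkRPAnyBeta`): the
Kogut–Susskind staggered central twist `T` by a central involution `z` with `ρ z = -1` maps the
torus Wilson measure at `β` onto the one at `-β` and reverses the plaquette. Here its action on
RECTANGULAR WILSON LOOPS (the objects of the cell's rows T1W/T2W, `Targets.lean`): the `2(R + T)`
staggered parities around an `R × T` rectangle in a coordinate plane sum to `R·T (mod 2)` — the
AREA PARITY (Stokes for the sign rule `dc = 1`) — so

* `lineWeight`, `lineHolonomy_centralTwist` — a straight line of `n` links collects the central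
  weight `∏_{t<n} s(y + t e_k, k)`; `lineWeight_stagTwist` — for the staggered weights with any
  axis last this is `z^{n · c(y, k)}` (the parity is constant along the line);
* `rectangleHolonomy_centralTwist`, ★ `rectangleHolonomy_stagTwist` — `U_{R×T} ↦ z^{RT} U_{R×T}`
  (`i ≠ j`); `wilsonLoop_stagTwist` — `W_{R×T}(T U) = (-1)^{RT} W_{R×T}(U)`;
  `meanWilsonLoop_stagTwist`;
* ★ `wilsonLoopExpectation_neg_of_even` — in the cell's vocabulary: for `M` even (so `SU(2)`),
  every `D`, every EVEN torus side `L`, every real `β_std` and all `R, T`: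
  `⟨W̄(R×T)⟩_{(ℤ/L)^D, SU(M), -β_std} = (-1)^{RT} ⟨W̄(R×T)⟩_{(ℤ/L)^D, SU(M), β_std}`;
  `wilsonLoopWindow_neg_of_even_area` / `_of_odd_area` — every `W(R×T)` window at `β` is the same
  window (even area) or the negated window (odd area) at `-β`; `t1W_neg_*`, `t2W_neg_*` for the
  cell's `SU(2)` rows.

What is NOT claimed: nothing for `SU(3)` (no central involution with `ρ z = -1`); nothing about
infinite volume; no new certificate. Structural; NOT a bound on any expectation.

References: L. Li, Y. Meurice, Phys. Rev. D 71 (2005) 016008 §II; J. Kogut, L. Susskind,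
Phys. Rev. D 11 (1975) 395; K. Wilson, Phys. Rev. D 10 (1974) 2445.
-/

noncomputable section

open MeasureTheory Complex
open Literature.MathematicalPhysics.QuantumFieldTheory (haarProbability Site GaugeConfig Plaquette
  wilsonMeasure wilsonExpectation lineHolonomy rectangleHolonomy wilsonLoop)
open Literature.MathematicalPhysics.QuantumLattice (fundamentalRep continuous_fundamentalRep
  fundamentalRep_apply)
open Literature.RepresentationTheory.CompactGroups

namespace Summit.QuantumFields.GaugeBoot

namespace TiltedRP

/-! ## A product of four twisted factors (central involutive weights) -/

section Algebra

variable {G : Type*} [Group G]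

/-- `(aA)(bB)(cC)⁻¹(fD)⁻¹ = (abcf) · (A B C⁻¹ D⁻¹)` for central weights `b, c, f` with
`c² = f² = 1`. -/
theorem twist_prod_four {a b c f A B C D : G} (hb : ∀ g, b * g = g * b)
    (hc : ∀ g, c * g = g * c) (hf : ∀ g, f * g = g * f) (hc2 : c * c = 1) (hf2 : f * f = 1) :
    a * A * (b * B) * (c * C)⁻¹ * (f * D)⁻¹ = a * b * c * f * (A * B * C⁻¹ * D⁻¹) := by
  have hci : c⁻¹ = c := inv_eq_of_mul_eq_one_right hc2
  have hfi : f⁻¹ = f := inv_eq_of_mul_eq_one_right hf2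
  have lb : ∀ g h : G, g * (b * h) = b * (g * h) := fun g h => by rw [← mul_assoc, ← hb g, mul_assoc]
  have lc : ∀ g h : G, g * (c * h) = c * (g * h) := fun g h => by rw [← mul_assoc, ← hc g, mul_assoc]
  have lf : ∀ g h : G, g * (f * h) = f * (g * h) := fun g h => by rw [← mul_assoc, ← hf g, mul_assoc]
  rw [mul_inv_rev, mul_inv_rev, hci, hfi]
  calc a * A * (b * B) * (C⁻¹ * c) * (D⁻¹ * f)
      = a * (A * (b * (B * (C⁻¹ * (c * (D⁻¹ * f)))))) := by simp only [mul_assoc]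
    _ = a * (b * (A * (B * (c * (C⁻¹ * (f * D⁻¹)))))) := by rw [lb, lc, ← hf D⁻¹]
    _ = a * (b * (A * (c * (B * (f * (C⁻¹ * D⁻¹)))))) := by rw [lc B, lf C⁻¹]
    _ = a * (b * (c * (A * (f * (B * (C⁻¹ * D⁻¹)))))) := by rw [lc A, lf B]
    _ = a * (b * (c * (f * (A * (B * (C⁻¹ * D⁻¹)))))) := by rw [lf A]
    _ = a * b * c * f * (A * B * C⁻¹ * D⁻¹) := by simp only [mul_assoc]

end Algebra

/-! ## Lines and rectangles under a central twist of the cubic torus -/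

section Lines

variable {d L N : ℕ} {G : Type*} [Group G]

/-- **The weight collected along a straight line**: `∏_{t<n} s(y + t e_k, k)` (ordered). -/
def lineWeight (s : Link (Site d L) d → G) (k : Fin d) : ℕ → Site d L → G
  | 0, _ => 1
  | n + 1, y => s (y, k) * lineWeight s k n (y.shift k)

namespace IsStaggering

variable {z : G} {s : Link (Site d L) d → G} (hs : IsStaggering (cubicUnit d L) z s)
include hs

/-- Line weights are central. -/
theorem lineWeight_comm (k : Fin d) (n : ℕ) (y : Site d L) (g : G) :
    lineWeight s k n y * g = g * lineWeight s k n y := by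
  induction n generalizing y with
  | zero => simp [lineWeight]
  | succ n ih => rw [lineWeight, mul_assoc, ih, ← mul_assoc, hs.comm, mul_assoc]

/-- Line weights square to one. -/
theorem lineWeight_mul_self (k : Fin d) (n : ℕ) (y : Site d L) :
    lineWeight s k n y * lineWeight s k n y = 1 := by
  induction n generalizing y with
  | zero => simp [lineWeight]
  | succ n ih =>
    rw [lineWeight]
    calc s (y, k) * lineWeight s k n (y.shift k) * (s (y, k) * lineWeight s k n (y.shift k))
        = s (y, k) * (lineWeight s k n (y.shift k) * s (y, k)) * lineWeight s k n (y.shift k) := by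
          simp only [mul_assoc]
      _ = s (y, k) * s (y, k) * (lineWeight s k n (y.shift k) * lineWeight s k n (y.shift k)) := by
          rw [hs.lineWeight_comm, ← mul_assoc, mul_assoc]
      _ = 1 := by rw [hs.mul_self, ih, one_mul]

/-- **Straight-line holonomies under the twist**: `P_n(T_s U) = (∏ weights) · P_n(U)`. -/
theorem lineHolonomy_centralTwist (U : GaugeConfig d L G) (k : Fin d) (n : ℕ) (y : Site d L) :
    lineHolonomy (centralTwist s U) k n y = lineWeight s k n y * lineHolonomy U k n y := by
  induction n generalizing y with
  | zero => simp [lineHolonomy, lineWeight]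
  | succ n ih =>
    simp only [lineHolonomy, lineWeight, ih]
    show s (y, k) * U (y, k) * (lineWeight s k n (y.shift k) * lineHolonomy U k n (y.shift k)) = _
    rw [mul_assoc, ← mul_assoc (U (y, k)), ← hs.lineWeight_comm, mul_assoc, mul_assoc]

/-- **Rectangle holonomies under the twist**: the four line weights come out in front. -/
theorem rectangleHolonomy_centralTwist (U : GaugeConfig d L G) (x : Site d L) (i j : Fin d)
    (R T : ℕ) :
    rectangleHolonomy (centralTwist s U) x i j R T =
      lineWeight s i R x * lineWeight s j T (x + Pi.single i (R : ZMod L)) *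
        lineWeight s i R (x + Pi.single j (T : ZMod L)) * lineWeight s j T x *
          rectangleHolonomy U x i j R T := by
  unfold rectangleHolonomy
  simp only [hs.lineHolonomy_centralTwist]
  exact twist_prod_four (hs.lineWeight_comm j T _) (hs.lineWeight_comm i R _)
    (hs.lineWeight_comm j T x) (hs.lineWeight_mul_self i R _) (hs.lineWeight_mul_self j T x)

end IsStaggering

end Lines

/-! ## The staggered weights along lines and around rectangles: the area parity -/

section Stag

variable {A : Type*} [AddCommGroup A] {d : ℕ} {e : Fin d → A}
variable {π : Fin d → A →+ ZMod 2} (hπ : IsDualParity e π) (r : Fin d)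
include hπ

/-- Translating the base point by `n · e_k` adds `n · [k ≺ m]` to the parity of an `m`-link. -/
theorem stagParity_add_nsmul_e (x : A) (k m : Fin d) (n : ℕ) :
    stagParity π r (x + n • e k, m) = stagParity π r (x, m) + n • (if PrecLast r k m then 1 else 0) := by
  induction n generalizing x with
  | zero => simp
  | succ n ih => rw [succ_nsmul, ← add_assoc, stagParity_add_e hπ, ih, succ_nsmul, add_assoc]

/-- The parity is constant along a straight line: `c(x + n e_k, k) = c(x, k)` (`k ⊀ k`). -/
theorem stagParity_add_nsmul_e_self (x : A) (k : Fin d) (n : ℕ) :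
    stagParity π r (x + n • e k, k) = stagParity π r (x, k) := by
  have h : ¬PrecLast r k k := fun h => by
    rcases h with ⟨hk, h | h⟩
    · exact hk h
    · exact lt_irrefl _ h
  rw [stagParity_add_nsmul_e hπ, if_neg h, smul_zero, add_zero]

end Stag

section StagTorus

variable {d L N : ℕ} {G : Type*} [Group G]

/-- `n : ZMod L` times `e_k` is `Pi.single k n`. -/
theorem nsmul_cubicUnit (k : Fin d) (n : ℕ) :
    n • cubicUnit d L k = Pi.single k (n : ZMod L) := by
  rw [cubicUnit, ← Pi.single_smul', nsmul_eq_mul, mul_one]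

variable (h2 : 2 ∣ L) (r : Fin d) {z : G}

/-- **The staggered weight of a straight line is `z^{n · c(y, k)}`** (the parity is constant along
the line). -/
theorem lineWeight_stagTwist (hz2 : z * z = 1) (k : Fin d) (n : ℕ) (y : Site d L) :
    lineWeight (stagTwist (cubicParity d L h2) r z) k n y =
      zpow₂ z (n • stagParity (cubicParity d L h2) r (y, k)) := by
  induction n generalizing y with
  | zero => simp [lineWeight, zpow₂]
  | succ n ih =>
    rw [lineWeight, ih, succ_nsmul', zpow₂_add hz2, stagTwist]
    congr 2
    have h1 : y.shift k = y + (1 : ℕ) • cubicUnit d L k := by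
      rw [one_nsmul]; rfl
    rw [h1, stagParity_add_nsmul_e_self (isDualParity_cubicParity d L h2)]

/-- ★ **The rectangle holonomy picks up `z^{RT}`** under the staggered twist (`i ≠ j`): the
`2(R + T)` parities around an `R × T` rectangle sum to the AREA PARITY `R·T`. -/
theorem rectangleHolonomy_stagTwist (hzc : ∀ g, z * g = g * z) (hz2 : z * z = 1)
    (U : GaugeConfig d L G) (x : Site d L) {i j : Fin d} (hij : i ≠ j) (R T : ℕ) :
    rectangleHolonomy (centralTwist (stagTwist (cubicParity d L h2) r z) U) x i j R T =
      zpow₂ z ((R * T : ℕ) : ZMod 2) * rectangleHolonomy U x i j R T := by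
  have hπ := isDualParity_cubicParity d L h2
  have hs := isStaggering_stagTwist hπ r hzc hz2
  rw [hs.rectangleHolonomy_centralTwist, lineWeight_stagTwist h2 r hz2,
    lineWeight_stagTwist h2 r hz2, lineWeight_stagTwist h2 r hz2,
    lineWeight_stagTwist h2 r hz2, ← zpow₂_add hz2, ← zpow₂_add hz2, ← zpow₂_add hz2,
    ← nsmul_cubicUnit, ← nsmul_cubicUnit, stagParity_add_nsmul_e hπ, stagParity_add_nsmul_e hπ]
  congr 2
  -- the area parity
  set ci := stagParity (cubicParity d L h2) r (x, i)
  set cj := stagParity (cubicParity d L h2) r (x, j)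
  have h2c : ∀ c : ZMod 2, c + c = 0 := by decide
  have hsq : ∀ (n : ℕ) (c : ZMod 2), n • c + n • c = 0 := fun n c => by
    rw [← nsmul_add, h2c, nsmul_zero]
  have hind : (if PrecLast r i j then (1 : ZMod 2) else 0) + (if PrecLast r j i then 1 else 0) = 1 := by
    by_cases h : PrecLast r i j
    · rw [if_pos h, if_neg ((precLast_xor hij).1 h), add_zero]
    · have h' : PrecLast r j i := by by_contra h'; exact h ((precLast_xor hij).2 h')
      rw [if_neg h, if_pos h', zero_add]
  calc R • ci + T • (cj + R • (if PrecLast r i j then (1 : ZMod 2) else 0)) +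
        R • (ci + T • (if PrecLast r j i then (1 : ZMod 2) else 0)) + T • cj
      = (R • ci + R • ci) + (T • cj + T • cj) +
          (T * R) • ((if PrecLast r i j then (1 : ZMod 2) else 0) +
            (if PrecLast r j i then (1 : ZMod 2) else 0)) := by
        rw [nsmul_add, nsmul_add, nsmul_add, mul_nsmul', mul_comm T R, mul_nsmul']
        abel
    _ = ((R * T : ℕ) : ZMod 2) := by
        rw [hsq, hsq, hind, zero_add, zero_add, mul_comm, nsmul_one]

variable (ρ : G →* Matrix (Fin N) (Fin N) ℂ)

/-- `ρ(z^{n mod 2}) = (-1)^n · 1` when `ρ z = -1`. -/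
theorem rep_zpow₂_natCast (hρz : ρ z = -1) (n : ℕ) :
    ρ (zpow₂ z ((n : ℕ) : ZMod 2)) = ((-1 : ℝ) ^ n : ℝ) • (1 : Matrix (Fin N) (Fin N) ℂ) := by
  rcases Nat.even_or_odd n with hn | hn
  · have h0 : ((n : ℕ) : ZMod 2) ≠ 1 := by
      rw [ZMod.natCast_eq_zero_iff_even.2 hn]; exact zero_ne_one
    rw [zpow₂, if_neg h0, map_one, hn.neg_one_pow, one_smul]
  · rw [zpow₂, if_pos (ZMod.natCast_eq_one_iff_odd.2 hn), hρz, hn.neg_one_pow, neg_smul, one_smul]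

/-- **`W_{R×T}(T U) = (-1)^{RT} W_{R×T}(U)`** for the rectangular Wilson loop observable of
`ConstructiveQFTWave0` (`i ≠ j`, `ρ z = -1`). -/
theorem wilsonLoop_stagTwist (hzc : ∀ g, z * g = g * z) (hz2 : z * z = 1) (hρz : ρ z = -1)
    (x : Site d L) {i j : Fin d} (hij : i ≠ j) (R T : ℕ) (U : GaugeConfig d L G) :
    wilsonLoop ρ x i j R T (centralTwist (stagTwist (cubicParity d L h2) r z) U) =
      (-1 : ℝ) ^ (R * T) * wilsonLoop ρ x i j R T U := by
  unfold wilsonLoop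
  rw [rectangleHolonomy_stagTwist h2 r hzc hz2 U x hij, map_mul, rep_zpow₂_natCast ρ hρz,
    smul_mul_assoc, one_mul, Matrix.trace_smul, Complex.smul_re, smul_eq_mul]
  ring

/-- **The torus-averaged Wilson loop under the twist**: `W̄(R×T)(T U) = (-1)^{RT} W̄(R×T)(U)`. -/
theorem meanWilsonLoop_stagTwist [NeZero L] (hzc : ∀ g, z * g = g * z) (hz2 : z * z = 1)
    (hρz : ρ z = -1) (R T : ℕ) (U : GaugeConfig d L G) :
    meanWilsonLoop ρ R T (centralTwist (stagTwist (cubicParity d L h2) r z) U) =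
      (-1 : ℝ) ^ (R * T) * meanWilsonLoop ρ R T U := by
  unfold meanWilsonLoop
  rw [Finset.mul_sum, Finset.mul_sum, Finset.mul_sum]
  refine Finset.sum_congr rfl fun p _ => ?_
  rw [wilsonLoop_stagTwist h2 r ρ hzc hz2 hρz p.1 (ne_of_lt p.2.2) R T U]
  ring

end StagTorus

end TiltedRP

/-! ## In the cell's vocabulary: `⟨W̄(R×T)⟩` of `SU(2n)` at `-β_std` -/

section Targets

open TiltedRP

/-- ★ **`⟨W̄(R×T)⟩_{(ℤ/L)^D, SU(M), -β_std} = (-1)^{RT} ⟨W̄(R×T)⟩_{(ℤ/L)^D, SU(M), β_std}`** for `M`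
even (so the cell's `SU(2)`), `L` even, every `D`, `β_std`, `R`, `T`: the staggered central twist by
`-1 ∈ SU(M)` maps the Wilson measure at `β_std/M` onto the one at `-β_std/M` and multiplies every
`R × T` rectangle by the area sign `(-1)^{RT}`. -/
theorem wilsonLoopExpectation_neg_of_even {M : ℕ} (hM : Even M) (D L : ℕ) [NeZero L] (hL : Even L)
    (β : ℝ) (R T : ℕ) :
    wilsonLoopExpectation M D L (-β) R T = (-1 : ℝ) ^ (R * T) * wilsonLoopExpectation M D L β R T := by
  haveI : SecondCountableTopology (Matrix (Fin M) (Fin M) ℂ) :=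
    inferInstanceAs (SecondCountableTopology (Fin M → Fin M → ℂ))
  haveI : SecondCountableTopology (Matrix.specialUnitaryGroup (Fin M) ℂ) :=
    Topology.IsEmbedding.subtypeVal.secondCountableTopology
  have h2 : 2 ∣ L := even_iff_two_dvd.1 hL
  set z : Matrix.specialUnitaryGroup (Fin M) ℂ := ⟨-1, neg_one_mem_specialUnitaryGroup_of_even hM⟩
    with hz
  have hzc : ∀ g, z * g = g * z := fun g => Subtype.ext (by simp [hz])
  have hz2 : z * z = 1 := Subtype.ext (by simp [hz])
  have hρz : suRep M z = -1 := rfl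
  unfold wilsonLoopExpectation wilsonExpectation
  rw [neg_div]
  rcases isEmpty_or_nonempty (Fin D) with hD | hD
  · have h0 : ∀ U : GaugeConfig D L (SU M), meanWilsonLoop (suRep M) R T U = 0 := fun U => by
      unfold meanWilsonLoop
      rw [Finset.sum_eq_zero fun p _ => (IsEmpty.false p.2.1.1).elim, mul_zero]
    simp [h0]
  · obtain ⟨r⟩ := hD
    rw [← cubicTorus_integral_comp_stagTwist (suRep M) h2 r (continuous_suRep M) hzc hz2 hρz (β / M)
      (meanWilsonLoop (suRep M) R T)]
    simp_rw [meanWilsonLoop_stagTwist h2 r (suRep M) hzc hz2 hρz]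
    exact integral_const_mul _ _

/-- **`W(R×T)` windows of even area transfer unchanged to `-β`** (`M` even). -/
theorem wilsonLoopWindow_neg_of_even_area {M : ℕ} (hM : Even M) {D L₀ : ℕ} {β : ℝ} {R T : ℕ}
    (hRT : Even (R * T)) {a b : ℝ} (h : WilsonLoopWindow M D L₀ β R T a b) :
    WilsonLoopWindow M D L₀ (-β) R T a b := by
  intro L _ hL hL₀
  rw [wilsonLoopExpectation_neg_of_even hM D L hL, hRT.neg_one_pow, one_mul]
  exact h L hL hL₀

/-- **`W(R×T)` windows of odd area transfer NEGATED to `-β`** (`M` even). -/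
theorem wilsonLoopWindow_neg_of_odd_area {M : ℕ} (hM : Even M) {D L₀ : ℕ} {β : ℝ} {R T : ℕ}
    (hRT : Odd (R * T)) {a b : ℝ} (h : WilsonLoopWindow M D L₀ β R T a b) :
    WilsonLoopWindow M D L₀ (-β) R T (-b) (-a) := by
  intro L _ hL hL₀
  obtain ⟨ha, hb⟩ := h L hL hL₀
  rw [wilsonLoopExpectation_neg_of_even hM D L hL, hRT.neg_one_pow, neg_one_mul]
  exact ⟨neg_le_neg hb, neg_le_neg ha⟩

/-- The cell's `SU(2)`, `D = 3` Wilson-loop rows at negative coupling, even area. -/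
theorem t1W_neg_of_even_area {L₀ : ℕ} {β : ℝ} {R T : ℕ} (hRT : Even (R * T)) {a b : ℝ}
    (h : T1W L₀ β R T a b) : T1W L₀ (-β) R T a b :=
  wilsonLoopWindow_neg_of_even_area even_two hRT h

/-- The cell's `SU(2)`, `D = 3` Wilson-loop rows at negative coupling, odd area. -/
theorem t1W_neg_of_odd_area {L₀ : ℕ} {β : ℝ} {R T : ℕ} (hRT : Odd (R * T)) {a b : ℝ}
    (h : T1W L₀ β R T a b) : T1W L₀ (-β) R T (-b) (-a) :=
  wilsonLoopWindow_neg_of_odd_area even_two hRT h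

/-- The cell's `SU(2)`, `D = 4` Wilson-loop rows at negative coupling, even area. -/
theorem t2W_neg_of_even_area {L₀ : ℕ} {β : ℝ} {R T : ℕ} (hRT : Even (R * T)) {a b : ℝ}
    (h : T2W L₀ β R T a b) : T2W L₀ (-β) R T a b :=
  wilsonLoopWindow_neg_of_even_area even_two hRT h

/-- The cell's `SU(2)`, `D = 4` Wilson-loop rows at negative coupling, odd area. -/
theorem t2W_neg_of_odd_area {L₀ : ℕ} {β : ℝ} {R T : ℕ} (hRT : Odd (R * T)) {a b : ℝ}
    (h : T2W L₀ β R T a b) : T2W L₀ (-β) R T (-b) (-a) :=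
  wilsonLoopWindow_neg_of_odd_area even_two hRT h

end Targets

end Summit.QuantumFields.GaugeBoot
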